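import Mathlib
import HarnessLib
import Summits.Ventures.LatticeQCDFlow.Exactness.NCMCGeneralSpaceRestartChainReweightedCLT
import Summits.Ventures.LatticeQCDFlow.Exactness.NCMCGeneralSpaceReplicaTStatisticIndep

/-!
# The engine's `reweight ± jackknife` bar over `R` independent streams of CORRELATED launches: its limiting coverage is `L_R(q)` — every bounded target observable, every protocol with bounded-below work, EVERY family of starts

HONEST FRAMING: exact (Metropolis-corrected) sampling algorithms for lattice gauge theory;
figures of merit are autocorrelation/cost numbers at stated couplings and volumes; no
continuum-physics claim.

Venture `LatticeQCDFlow` (cell pub-lqcd), topic `Exactness`; FANOUT row 13 (`eng-snf`, GEN-24).  NEW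
WORK of the cell — the composition of GEN-22
`CrooksPair.tendstoInDistribution_reweighted_restartChain` (the reweighting lane's CLT
`√n (R_n − Z₁⁻¹∫f dν₁) ⇒ N(0, σ²_c/(Z₁/Z₀)²)` along the restart chain from EVERY initial record law)
with GEN-23 I `tendsto_measure_abs_studentised_le_of_indep` (the
"independent runs" bar of ANY asymptotically normal estimator has the limiting coverage
`L_R(q) = N(0,1)^{⊗R}{|t| ≤ q}`).  Companion of `NCMCGeneralSpaceReplicaJarzynskiJackknife` (the
`free_energy` lane).  No definition; nothing cited as a fact.

WHY (row 13).  `latflow-snf`'s `estimators.reweight` computes the Jarzynski-reweighted target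
expectation `R_n = (Σ_i e^{−W_i} f(e(ω_i)))/(Σ_i e^{−W_i})` of an observable `f` of the switched
configuration; run over a batch of `R` independent streams of correlated launches it prints the
replica mean with the between-stream (jackknife) standard error.  As for `free_energy`, that bar
read with a quantile `q` has, for EVERY family of initial record laws, the limiting coverage
`L_R(q)` — Student's ratio probability (GEN-24 `NCMCGeneralSpaceReplicaTStatisticStudent`),
`(2/π)·arctan q` at `R = 2` (`NCMCGeneralSpaceReplicaTStatisticTwoReplicas`), never more than the
normal coverage (`NCMCGeneralSpaceReplicaTStatisticUndercoverage`).

## Content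
* **`CrooksPair.tendsto_measure_abs_reweightedReplicaT_le_restartChains`** — Crooks pair,
  `Z₀, Z₁ ≠ 0`, `−B ≤ W`, `K` Markov `ν₀`-invariant dominating a non-zero finite `m` from every
  configuration, `f` measurable with `|f| ≤ C_f`, `σ²_c > 0` (the Green–Kubo variance of
  `e^{−W}(f∘e − μ_f)` along the restart chain, in GEN-22's form), `R ≥ 2` independent streams with
  ANY initial record laws, `q ≥ 0`:
  `P(|(R̄_n − μ_f)/ŝe_n| ≤ q) → L_R(q)`, `μ_f = Z₁⁻¹ ∫ f dν₁`;
  **`…_everyStart`** — stream `r` launched from ANY configuration `x_r`.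

NOT CLAIMED: unbounded work or observables; dependent streams; the checkable form of `σ²_c > 0`
(GEN-23 V2 `CrooksPair.reweightVariance_pos_iff`, stated for the centred observable — the centring
constant vanishes by the reweighting identity; not re-derived here); anything numerical.
-/

namespace Summit.Ventures.LatticeQCDFlow.Exactness.GeneralNCMC

open MeasureTheory ProbabilityTheory Set Filter Finset
open scoped ENNReal NNReal Topology

variable {Ω E : Type*} [MeasurableSpace Ω] [MeasurableSpace E]

namespace CrooksPair

variable {ν₀ ν₁ : Measure Ω} [IsFiniteMeasure ν₀] [IsFiniteMeasure ν₁] {κF κR : Kernel Ω E}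
  [IsMarkovKernel κF] [IsMarkovKernel κR] {s e : E → Ω} {W : E → ℝ}
  {ι : Type*} [Fintype ι] [Nontrivial ι]

/-- The reweighted estimate read off the first `n` records of a stream is measurable in the
stream. -/
theorem measurable_reweightedEstimate_run (hW : Measurable W) (he : Measurable e) {f : Ω → ℝ}
    (hf : Measurable f) (n : ℕ) :
    Measurable fun ω : ℕ → E => (∑ i ∈ range n, Real.exp (-W (ω i)) * f (e (ω i))) /
      (∑ i ∈ range n, Real.exp (-W (ω i))) := by
  have hc : ∀ i : ℕ, Measurable fun ω : ℕ → E => ω i := fun i => measurable_pi_apply i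
  refine (Finset.measurable_sum _ fun i _ => ?_).div (Finset.measurable_sum _ fun i _ => ?_)
  · exact ((Real.measurable_exp.comp (hW.comp (hc i)).neg).mul (hf.comp (he.comp (hc i))))
  · exact Real.measurable_exp.comp (hW.comp (hc i)).neg

/-- **THE ENGINE'S `reweight ± q·ŝe_JK` BAR OVER `R ≥ 2` INDEPENDENT STREAMS OF CORRELATED LAUNCHES
HAS LIMITING COVERAGE `L_R(q)`, FROM EVERY FAMILY OF INITIAL RECORD LAWS.** -/
theorem tendsto_measure_abs_reweightedReplicaT_le_restartChains (K : Kernel Ω Ω) [IsMarkovKernel K]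
    (h0 : ν₀ univ ≠ 0) (h1 : ν₁ univ ≠ 0) (hK : Kernel.Invariant K ν₀)
    (h : CrooksPair ν₀ ν₁ κF κR s e W) {m : Measure Ω} [IsFiniteMeasure m] (hm0 : m univ ≠ 0)
    (hmin : ∀ z, m ≤ K z) {B : ℝ} (hB : ∀ ω, -B ≤ W ω) {f : Ω → ℝ} (hfm : Measurable f) {Cf : ℝ}
    (hCf : ∀ y, |f y| ≤ Cf)
    (hσ : 0 < (∫ ω, (Real.exp (-W ω) * (f (e ω) - ((ν₁ univ)⁻¹).toReal * ∫ y, f y ∂ν₁)) ^ 2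
          ∂(fwdPathLaw ν₀ κF))
      + 2 * ∑' k, ∫ ω, (Real.exp (-W ω) * (f (e ω) - ((ν₁ univ)⁻¹).toReal * ∫ y, f y ∂ν₁))
        * (Scoring.kop ((κF ∘ₖ K).comap s h.measurable_s))^[k + 1]
            (fun ω => Real.exp (-W ω) * (f (e ω) - ((ν₁ univ)⁻¹).toReal * ∫ y, f y ∂ν₁)) ω
          ∂(fwdPathLaw ν₀ κF))
    (μ : ι → Measure E) [∀ r, IsProbabilityMeasure (μ r)]
    [∀ r, IsProbabilityMeasure (Kernel.trajMeasure (X := fun _ : ℕ => E) (μ r)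
        (fun n : ℕ => ((κF ∘ₖ K).comap s h.measurable_s).comap
          (fun hh : (j : ↥(Finset.Iic n)) → E => hh ⟨n, Finset.mem_Iic.2 le_rfl⟩)
          (measurable_pi_apply _)))] {q : ℝ} (hq : 0 ≤ q) :
    Tendsto (fun n : ℕ => (Measure.pi fun r => Kernel.trajMeasure (X := fun _ : ℕ => E) (μ r)
        (fun n : ℕ => ((κF ∘ₖ K).comap s h.measurable_s).comap
          (fun hh : (j : ↥(Finset.Iic n)) → E => hh ⟨n, Finset.mem_Iic.2 le_rfl⟩)
          (measurable_pi_apply _)))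
        {ω : ι → ℕ → E |
          |((∑ r, (∑ i ∈ range n, Real.exp (-W (ω r i)) * f (e (ω r i))) /
                (∑ i ∈ range n, Real.exp (-W (ω r i)))) / Fintype.card ι
              - ((ν₁ univ)⁻¹).toReal * ∫ y, f y ∂ν₁)
            / Real.sqrt ((∑ r,
                ((∑ i ∈ range n, Real.exp (-W (ω r i)) * f (e (ω r i))) /
                    (∑ i ∈ range n, Real.exp (-W (ω r i)))
                  - (∑ r', (∑ i ∈ range n, Real.exp (-W (ω r' i)) * f (e (ω r' i))) /
                      (∑ i ∈ range n, Real.exp (-W (ω r' i)))) / Fintype.card ι) ^ 2)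
              / ((Fintype.card ι : ℝ) * (Fintype.card ι - 1)))| ≤ q})
      atTop
      (𝓝 ((Measure.pi fun _ : ι => gaussianReal 0 1) {z : ι → ℝ | |(∑ r, z r) / Fintype.card ι
        / Real.sqrt ((∑ r, (z r - (∑ r', z r') / Fintype.card ι) ^ 2)
            / ((Fintype.card ι : ℝ) * (Fintype.card ι - 1)))| ≤ q})) := by
  set θ : ℝ := ((ν₀ univ)⁻¹ * ν₁ univ).toReal with hθdef
  have hθ : 0 < θ := by
    rw [hθdef, ENNReal.toReal_mul, ENNReal.toReal_inv]
    exact mul_pos (inv_pos.2 (ENNReal.toReal_pos h0 (measure_ne_top _ _)))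
      (ENNReal.toReal_pos h1 (measure_ne_top _ _))
  set σ2 : ℝ := (∫ ω, (Real.exp (-W ω) * (f (e ω) - ((ν₁ univ)⁻¹).toReal * ∫ y, f y ∂ν₁)) ^ 2
          ∂(fwdPathLaw ν₀ κF))
      + 2 * ∑' k, ∫ ω, (Real.exp (-W ω) * (f (e ω) - ((ν₁ univ)⁻¹).toReal * ∫ y, f y ∂ν₁))
        * (Scoring.kop ((κF ∘ₖ K).comap s h.measurable_s))^[k + 1]
            (fun ω => Real.exp (-W ω) * (f (e ω) - ((ν₁ univ)⁻¹).toReal * ∫ y, f y ∂ν₁)) ω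
          ∂(fwdPathLaw ν₀ κF) with hσ2
  have hv : (σ2 / θ ^ 2).toNNReal ≠ 0 := by
    rw [Ne, Real.toNNReal_eq_zero, not_le]
    exact div_pos hσ (pow_pos hθ 2)
  have hclt : ∀ r : ι, TendstoInDistribution (fun (n : ℕ) (ω : ℕ → E) =>
        Real.sqrt (n : ℝ) * ((∑ i ∈ range n, Real.exp (-W (ω i)) * f (e (ω i))) /
          (∑ i ∈ range n, Real.exp (-W (ω i))) - ((ν₁ univ)⁻¹).toReal * ∫ y, f y ∂ν₁))
      atTop id (fun _ => Kernel.trajMeasure (X := fun _ : ℕ => E) (μ r)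
        (fun n : ℕ => ((κF ∘ₖ K).comap s h.measurable_s).comap
          (fun hh : (j : ↥(Finset.Iic n)) → E => hh ⟨n, Finset.mem_Iic.2 le_rfl⟩)
          (measurable_pi_apply _))) (gaussianReal 0 (σ2 / θ ^ 2).toNNReal) := fun r =>
    h.tendstoInDistribution_reweighted_restartChain K h0 h1 hK hm0 hmin hB hfm hCf (μ r)
      (P' := gaussianReal 0 (σ2 / θ ^ 2).toNNReal) (Y := id) HasLaw.id
  exact tendsto_measure_abs_studentised_le_of_indep (Ω := fun _ : ι => ℕ → E)
    (θhat := fun (_ : ι) (n : ℕ) (ω : ℕ → E) =>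
      (∑ i ∈ range n, Real.exp (-W (ω i)) * f (e (ω i))) / (∑ i ∈ range n, Real.exp (-W (ω i))))
    (fun _ n => measurable_reweightedEstimate_run h.measurable_W h.measurable_e hfm n)
    (((ν₁ univ)⁻¹).toReal * ∫ y, f y ∂ν₁) hv hclt hq

/-- **The engine's form**: stream `r` is launched from ANY configuration `x_r`
(`μ_r = κF(x_r, ·)`). -/
theorem tendsto_measure_abs_reweightedReplicaT_le_restartChains_everyStart (K : Kernel Ω Ω)
    [IsMarkovKernel K] (h0 : ν₀ univ ≠ 0) (h1 : ν₁ univ ≠ 0) (hK : Kernel.Invariant K ν₀)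
    (h : CrooksPair ν₀ ν₁ κF κR s e W) {m : Measure Ω} [IsFiniteMeasure m] (hm0 : m univ ≠ 0)
    (hmin : ∀ z, m ≤ K z) {B : ℝ} (hB : ∀ ω, -B ≤ W ω) {f : Ω → ℝ} (hfm : Measurable f) {Cf : ℝ}
    (hCf : ∀ y, |f y| ≤ Cf)
    (hσ : 0 < (∫ ω, (Real.exp (-W ω) * (f (e ω) - ((ν₁ univ)⁻¹).toReal * ∫ y, f y ∂ν₁)) ^ 2
          ∂(fwdPathLaw ν₀ κF))
      + 2 * ∑' k, ∫ ω, (Real.exp (-W ω) * (f (e ω) - ((ν₁ univ)⁻¹).toReal * ∫ y, f y ∂ν₁))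
        * (Scoring.kop ((κF ∘ₖ K).comap s h.measurable_s))^[k + 1]
            (fun ω => Real.exp (-W ω) * (f (e ω) - ((ν₁ univ)⁻¹).toReal * ∫ y, f y ∂ν₁)) ω
          ∂(fwdPathLaw ν₀ κF))
    (x : ι → Ω)
    [∀ r, IsProbabilityMeasure (Kernel.trajMeasure (X := fun _ : ℕ => E) (κF (x r))
        (fun n : ℕ => ((κF ∘ₖ K).comap s h.measurable_s).comap
          (fun hh : (j : ↥(Finset.Iic n)) → E => hh ⟨n, Finset.mem_Iic.2 le_rfl⟩)
          (measurable_pi_apply _)))] {q : ℝ} (hq : 0 ≤ q) :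
    Tendsto (fun n : ℕ => (Measure.pi fun r => Kernel.trajMeasure (X := fun _ : ℕ => E) (κF (x r))
        (fun n : ℕ => ((κF ∘ₖ K).comap s h.measurable_s).comap
          (fun hh : (j : ↥(Finset.Iic n)) → E => hh ⟨n, Finset.mem_Iic.2 le_rfl⟩)
          (measurable_pi_apply _)))
        {ω : ι → ℕ → E |
          |((∑ r, (∑ i ∈ range n, Real.exp (-W (ω r i)) * f (e (ω r i))) /
                (∑ i ∈ range n, Real.exp (-W (ω r i)))) / Fintype.card ι
              - ((ν₁ univ)⁻¹).toReal * ∫ y, f y ∂ν₁)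
            / Real.sqrt ((∑ r,
                ((∑ i ∈ range n, Real.exp (-W (ω r i)) * f (e (ω r i))) /
                    (∑ i ∈ range n, Real.exp (-W (ω r i)))
                  - (∑ r', (∑ i ∈ range n, Real.exp (-W (ω r' i)) * f (e (ω r' i))) /
                      (∑ i ∈ range n, Real.exp (-W (ω r' i)))) / Fintype.card ι) ^ 2)
              / ((Fintype.card ι : ℝ) * (Fintype.card ι - 1)))| ≤ q})
      atTop
      (𝓝 ((Measure.pi fun _ : ι => gaussianReal 0 1) {z : ι → ℝ | |(∑ r, z r) / Fintype.card ι
        / Real.sqrt ((∑ r, (z r - (∑ r', z r') / Fintype.card ι) ^ 2)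
            / ((Fintype.card ι : ℝ) * (Fintype.card ι - 1)))| ≤ q})) :=
  h.tendsto_measure_abs_reweightedReplicaT_le_restartChains K h0 h1 hK hm0 hmin hB hfm hCf hσ
    (fun r => κF (x r)) hq

end CrooksPair

end Summit.Ventures.LatticeQCDFlow.Exactness.GeneralNCMC
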